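import Summits.HodgeConjecture.HodgeConjecture.Theorems.UeP4bFlatLevelReadingsPins
import Literature.AlgebraicGeometry.Motives.ConstantFamilyFibre
import HarnessLib

/-!
# U-e P4 (B2b-piece), pins: the pinned identification of the fibres of a BASE-CHANGED universal family

Cell hodgecm-mathlib (D-0151), rung 0 of the Mumford line under `HDel` (item `stmt-HodgeConjecture-24835`), (U)-HEAD, node
U-e, socket P4 in PIECE currency (B-plan1 (g13) GO-PIECE 18:25:29Z «P4 is local on the base»; P4 lead B-p03 (g14), texts
`B-provers/B-p03/piece/`); hand B-p16 (g12).  THEOREMS ONLY; books 0.  HC_CM is proved only modulo the 7 printed citations until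
rung 0 closes; nothing here changes that count.

The piece road replaces the complexified universal family `f := W1.univFamilyℂ 𝓜 : X ⊗ ℂ → M ⊗ ℂ` by its base change
`f₁ := familyPullback.snd f g : (X ⊗ ℂ) ×_{M ⊗ ℂ} S′ → S′` along a morphism `g : S′ → M ⊗ ℂ` (an open piece in the application).
For a complex point `y` of `S′` and a fibre triple `P′` over `Spec ℂ` with base-change witnesses `(G, Ĝ)` along the `ℚ`-side reading
of `g(y)`, the PINNED identification of ★ `UeP4bFlatLevelReadingsPins` extends by the fibre seam ★ `fiberOverFamilyPullbackIso`:
`e₁ := (fibreAVIso P′ ≪≫ fiberUnivIso⁻¹ ≪≫ (fiberOverFamilyPullbackIso f g y)⁻¹)(ℂ) : (P′.A)_𝟙(ℂ) ≃ₜ (f₁)⁻¹(y)(ℂ)`.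
This file transports the pins (P3)/(P4) to `e₁`:
* `eq_of_map_fst_eq_of_map_snd_eq` — a complex point of `𝒳 ×_S S′` is determined by its two projections;
* `map_fiberι_comp_eq_base` — a point of the fibre `f⁻¹(y)` maps to `y` under `f`;
* `map_fst_fiberι_piecePinned` — the `X ⊗ ℂ`-projection of `e₁ Q` pushed into the total space of `f₁` is `e Q` pushed into `X ⊗ ℂ`;
* (P3′) `map_fiberι_piecePinned_restrictPt` — SECTIONS: for a lift `σ₁ : S′ → (X ⊗ ℂ) ×_{M ⊗ ℂ} S′` of the universal section
  (`σ₁ ≫ fst = g ≫ (σᵢ ⊗ ℂ)`, `σ₁ ≫ f₁ = 𝟙`), `e₁ (σ′ᵢ(𝟙))` pushed into the total space is `σ₁(y)`;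
* (P4′) `map_fiberι_piecePinned_pow` — POWERS: for a lift `nX₁` of `[N] ⊗ ℂ` (`nX₁ ≫ fst = fst ≫ ([N] ⊗ ℂ)`, `nX₁ ≫ f₁ = f₁`),
  `e₁ (Q ^ N)` pushed into the total space is `nX₁` of `e₁ Q` pushed into the total space.

## References
* [MumfordFogartyKirwan1994] D. Mumford, J. Fogarty, F. Kirwan, *Geometric Invariant Theory*, 3rd ed. (1994), Ch. 7 §2
  Definition 7.2, Definition 7.3 (p. 129); Appendix to Ch. 7 §A (p. 235).
* [Hartshorne1977] R. Hartshorne, *Algebraic Geometry* (1977), Ch. II §3 p. 89 (fibres and base extension).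
-/

set_option autoImplicit false

-- mandated namespace `Summit.HodgeConjecture.HodgeConjecture.Theorems` trips `linter.dupNamespace` (single-problem summit; the lakefile turns
-- the linter off tree-wide as a weak option), restated here so stand-alone elaboration is warning-free (as in ★ `SiegelUniversalFamilyHodgeFrames`).
set_option linter.dupNamespace false

noncomputable section

open CategoryTheory CategoryTheory.Limits AlgebraicGeometry MonoidalCategory CartesianMonoidalCategory
open _root_.Topology _root_.Filter
open scoped MonObj

namespace Summit.HodgeConjecture.HodgeConjecture.Theorems

namespace UnivFamilyLevelReadings

open Literature.AlgebraicGeometry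
open Literature.AlgebraicGeometry.Motives
open Literature.AlgebraicGeometry.HodgeTheory
open Literature.AlgebraicGeometry.AbelianSchemes (PolarizedAbelianSchemeWithLevel AbelianSchemeOver)
open Literature.AlgebraicGeometry.ModuliOfAbelianVarieties
open Literature.AlgebraicGeometry.ModuliOfAbelianVarieties.W1

/-! ### §P0 Complex points of a base change and of a fibre -/

section Generic

variable {𝒳 S S' : SchemeOver ℂ} (f : 𝒳 ⟶ S) (gS : S' ⟶ S)

/-- A complex point of `𝒳 ×_S S′` is determined by its projections to `𝒳` and to `S′`. [cite: Hartshorne1977, Ch. II §3 p. 89] -/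
theorem eq_of_map_fst_eq_of_map_snd_eq {R₁ R₂ : ComplexPoints (familyPullback f gS)}
    (h₁ : AlgPoints.map (familyPullback.fst f gS) R₁ = AlgPoints.map (familyPullback.fst f gS) R₂)
    (h₂ : AlgPoints.map (familyPullback.snd f gS) R₁ = AlgPoints.map (familyPullback.snd f gS) R₂) : R₁ = R₂ := by
  ext : 1
  apply pullback.hom_ext
  · exact congrArg CommaMorphism.left h₁
  · exact congrArg CommaMorphism.left h₂

/-- A complex point of the fibre `f⁻¹(y)`, pushed into `𝒳` and down to `S`, is `y`. [cite: Hartshorne1977, Ch. II §3 p. 89] -/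
theorem map_fiberι_comp_eq_base (y : ComplexPoints S) (X : ComplexPoints (fiberOver f y)) :
    AlgPoints.map (fiberι f y ≫ f) X = y := by
  rw [fiberι_comp, AlgPoints.map_comp_apply, Subsingleton.elim (AlgPoints.map (fiberOverToSpec f y) X) (𝟙 _),
    AlgPoints.map_apply, Category.id_comp]

end Generic

/-! ### §P1 The piece-pinned identification `e₁ = (fibreAVIso ≪≫ fiberUnivIso⁻¹ ≪≫ fiberOverFamilyPullbackIso⁻¹)(ℂ)` -/

section PiecePins

variable {g N : ℕ} {δ : Fin g → ℕ} (𝓜 : SiegelFineModuliScheme g N δ) {S' : SchemeOver ℂ}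
  (gS : S' ⟶ (Motives.baseChange ℚ ℂ).obj 𝓜.M) (y : ComplexPoints S')
  (P' : PolarizedAbelianSchemeWithLevel g N δ (specOver ℚ ℂ).left)
  (G : P'.A.X.left ⟶ 𝓜.univ.A.X.left) (Ĝ : P'.D.hat.X.left ⟶ 𝓜.univ.D.hat.X.left)
  (h : P'.IsBaseChangeVia 𝓜.univ
    ((AlgPoints.baseChangeEquiv (algebraMap ℚ ℂ) 𝓜.M).symm (AlgPoints.map gS y)).left G Ĝ)

/-- **The `X ⊗ ℂ`-projection of the piece-pinned point.**  Pushing `e₁ Q` into the total space `(X ⊗ ℂ) ×_{M ⊗ ℂ} S′` and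
projecting to `X ⊗ ℂ` gives the pinned point `e Q` of ★ `UeP4bFlatLevelReadingsPins` pushed into `X ⊗ ℂ`
(★ `fiberOverFamilyPullbackIso_hom_fiberι`). [cite: MumfordFogartyKirwan1994, Ch. 7 §2 Definition 7.3 (p. 129)]
[cite: Hartshorne1977, Ch. II §3 p. 89] -/
theorem map_fst_fiberι_piecePinned (Q : ((P'.A.fibre (𝟙 (Spec (CommRingCat.of ℂ)))).toAbelianVariety).Points ℂ) :
    AlgPoints.map (familyPullback.fst (univFamilyℂ 𝓜) gS)
        (AlgPoints.map (fiberι (familyPullback.snd (univFamilyℂ 𝓜) gS) y)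
          (AlgPoints.homeomorphOfIso (L := ℂ)
            (fibreAVIso P' ≪≫ (fiberUnivIsoOfIsBaseChangeVia 𝓜 (AlgPoints.map gS y) P' G Ĝ h).symm ≪≫
              (fiberOverFamilyPullbackIso (univFamilyℂ 𝓜) gS y).symm) Q)) =
      AlgPoints.map (fiberι (univFamilyℂ 𝓜) (AlgPoints.map gS y))
        (AlgPoints.homeomorphOfIso (L := ℂ)
          (fibreAVIso P' ≪≫ (fiberUnivIsoOfIsBaseChangeVia 𝓜 (AlgPoints.map gS y) P' G Ĝ h).symm) Q) := by
  have hsq : (fiberOverFamilyPullbackIso (univFamilyℂ 𝓜) gS y).inv ≫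
      fiberι (familyPullback.snd (univFamilyℂ 𝓜) gS) y ≫ familyPullback.fst (univFamilyℂ 𝓜) gS =
      fiberι (univFamilyℂ 𝓜) (AlgPoints.map gS y) := by
    rw [← fiberOverFamilyPullbackIso_hom_fiberι, Iso.inv_hom_id_assoc]
  rw [AlgPoints.coe_homeomorphOfIso, AlgPoints.coe_homeomorphOfIso]
  simp only [AlgPoints.map_apply, Iso.trans_hom, Iso.symm_hom, Category.assoc]
  erw [hsq]
  rfl

/-- **(P3′) SECTIONS, piece form.**  For a lift `σ₁ : S′ → (X ⊗ ℂ) ×_{M ⊗ ℂ} S′` of the universal section through the piece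
(`σ₁ ≫ fst = gS ≫ (σM ⊗ ℂ)`, `σ₁ ≫ f₁ = 𝟙`), `e₁ (σ′ᵢ(𝟙))` pushed into the total space of `f₁` is the complex point `σ₁(y)`.
[cite: MumfordFogartyKirwan1994, Ch. 7 §2 Definition 7.2, Definition 7.3 (p. 129)] -/
theorem map_fiberι_piecePinned_restrictPt (i : Fin g ⊕ Fin g) (σM : 𝓜.M ⟶ univTotal 𝓜)
    (hσM : σM.left = (𝓜.univ.level.σ i).left)
    (σ₁ : S' ⟶ familyPullback (univFamilyℂ 𝓜) gS)
    (hσ₁ : σ₁ ≫ familyPullback.fst (univFamilyℂ 𝓜) gS = gS ≫ (Motives.baseChange ℚ ℂ).map σM)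
    (hσ₁' : σ₁ ≫ familyPullback.snd (univFamilyℂ 𝓜) gS = 𝟙 S') :
    AlgPoints.map (fiberι (familyPullback.snd (univFamilyℂ 𝓜) gS) y)
        (AlgPoints.homeomorphOfIso (L := ℂ)
          (fibreAVIso P' ≪≫ (fiberUnivIsoOfIsBaseChangeVia 𝓜 (AlgPoints.map gS y) P' G Ĝ h).symm ≪≫
            (fiberOverFamilyPullbackIso (univFamilyℂ 𝓜) gS y).symm)
          (P'.A.restrictPt (𝟙 (Spec (CommRingCat.of ℂ))) (P'.level.σ i))) =
      AlgPoints.map σ₁ y := by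
  apply eq_of_map_fst_eq_of_map_snd_eq (univFamilyℂ 𝓜) gS
  · rw [map_fst_fiberι_piecePinned, map_fiberι_pinned_restrictPt 𝓜 (AlgPoints.map gS y) P' G Ĝ h i σM hσM,
      ← AlgPoints.map_comp_apply, ← AlgPoints.map_comp_apply, hσ₁]
  · rw [← AlgPoints.map_comp_apply, ← AlgPoints.map_comp_apply, map_fiberι_comp_eq_base, hσ₁', AlgPoints.map_id_apply]

/-- **(P4′) POWERS, piece form.**  For a lift `nX₁` of `[N] ⊗ ℂ` to the total space of `f₁` (`nX₁ ≫ fst = fst ≫ (nX ⊗ ℂ)`,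
`nX₁ ≫ f₁ = f₁`), `e₁ (Q ^ N)` pushed into the total space is `nX₁` of `e₁ Q` pushed into the total space.
[cite: MumfordFogartyKirwan1994, Ch. 7 §2 Definition 7.2, Definition 7.3 (p. 129)] -/
theorem map_fiberι_piecePinned_pow (n : ℕ) (nX : univTotal 𝓜 ⟶ univTotal 𝓜)
    (hnX : nX.left = (((𝟙 𝓜.univ.A.X : 𝓜.univ.A.X ⟶ 𝓜.univ.A.X) ^ n).left : 𝓜.univ.A.X.left ⟶ 𝓜.univ.A.X.left))
    (nX₁ : familyPullback (univFamilyℂ 𝓜) gS ⟶ familyPullback (univFamilyℂ 𝓜) gS)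
    (hnX₁ : nX₁ ≫ familyPullback.fst (univFamilyℂ 𝓜) gS =
      familyPullback.fst (univFamilyℂ 𝓜) gS ≫ (Motives.baseChange ℚ ℂ).map nX)
    (hnX₁' : nX₁ ≫ familyPullback.snd (univFamilyℂ 𝓜) gS = familyPullback.snd (univFamilyℂ 𝓜) gS)
    (Q : ((P'.A.fibre (𝟙 (Spec (CommRingCat.of ℂ)))).toAbelianVariety).Points ℂ) :
    AlgPoints.map (fiberι (familyPullback.snd (univFamilyℂ 𝓜) gS) y)
        (AlgPoints.homeomorphOfIso (L := ℂ)
          (fibreAVIso P' ≪≫ (fiberUnivIsoOfIsBaseChangeVia 𝓜 (AlgPoints.map gS y) P' G Ĝ h).symm ≪≫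
            (fiberOverFamilyPullbackIso (univFamilyℂ 𝓜) gS y).symm) (Q ^ n)) =
      AlgPoints.map nX₁
        (AlgPoints.map (fiberι (familyPullback.snd (univFamilyℂ 𝓜) gS) y)
          (AlgPoints.homeomorphOfIso (L := ℂ)
            (fibreAVIso P' ≪≫ (fiberUnivIsoOfIsBaseChangeVia 𝓜 (AlgPoints.map gS y) P' G Ĝ h).symm ≪≫
              (fiberOverFamilyPullbackIso (univFamilyℂ 𝓜) gS y).symm) Q)) := by
  apply eq_of_map_fst_eq_of_map_snd_eq (univFamilyℂ 𝓜) gS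
  · rw [map_fst_fiberι_piecePinned, map_fiberι_pinned_pow 𝓜 (AlgPoints.map gS y) P' G Ĝ h n nX hnX,
      ← map_fst_fiberι_piecePinned 𝓜 gS y P' G Ĝ h Q,
      ← AlgPoints.map_comp_apply (familyPullback.fst (univFamilyℂ 𝓜) gS) ((Motives.baseChange ℚ ℂ).map nX),
      ← AlgPoints.map_comp_apply nX₁ (familyPullback.fst (univFamilyℂ 𝓜) gS), hnX₁]
  · rw [← AlgPoints.map_comp_apply, ← AlgPoints.map_comp_apply, ← AlgPoints.map_comp_apply, hnX₁',
      map_fiberι_comp_eq_base, map_fiberι_comp_eq_base]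

end PiecePins

/-! ### §P2 THE (B2b-piece) HEAD: the level sections read by ONE rational vector through a flat marking family, on a piece -/

section PieceHead

open Literature.AlgebraicTopology.SingularHomology
open Literature.Geometry.Kaehler (ComplexTorus)
open Literature.NumberTheory.Adeles SiegelModuli

variable {g N : ℕ} {δ : Fin g → ℕ}

/-- **U-e P4 (B2b-piece): the level sections of the universal family RESTRICTED TO A PIECE `ιS : S′ → M ⊗ ℂ` read by ONE rational
vector through a flat marking family.**  Same statement as ★ `levelSection_eq_r_of_flatFrame` (p732419) with the base re-threaded
along an open immersion `ιS` (`S′` quasi-projective and smooth of relative dimension `d` over `ℂ`): the family is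
`f₁ := familyPullback.snd (W1.univFamilyℂ 𝓜) ιS`, the points `x ∈ W ⊆ S′(ℂ)`, the fibre triples `P′ x` are classified along the
`ℚ`-side readings of `ιS x`, the frame `fr` lives in `H¹` of the fibres of `f₁` and is flat for the transport of `f₁` over `W`, and the
markings' lattice frame is read through the piece-pinned identifications
`e₁ x := (fibreAVIso (P′ x) ≪≫ fiberUnivIso⁻¹ ≪≫ (fiberOverFamilyPullbackIso f ιS x)⁻¹)(ℂ)`.  PROOF = ★ (E2-core)
`torsionReading_const_of_flatFrame_family` on `f₁` with the piece pins (P3′)/(P4′) (`σ₁`, `nX₁` = the universal section and `[N]`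
lifted to `(X ⊗ ℂ) ×_{M ⊗ ℂ} S′` by `pullback.lift`), exactly as in the un-pieced head.
[cite: MumfordFogartyKirwan1994, Ch. 7 §2 Definition 7.2, Definition 7.3 (p. 129); Appendix to Ch. 7 §A (p. 235)]
[cite: Milne2005ShimuraVarieties, §6 Thm. 6.11 pp. 74–75 and §12 (63) p. 116] [cite: VoisinHodgeI2002, §9.2.1] -/
theorem levelSection_eq_r_of_flatFrame_piece (hN : 3 ≤ N) (𝓜 : SiegelFineModuliScheme g N δ) (r : gspFinAdelic δ)
    {S' : SchemeOver ℂ} (ιS : S' ⟶ (Motives.baseChange ℚ ℂ).obj 𝓜.M) [IsOpenImmersion ιS.left]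
    (hSq : IsQuasiProjectiveOver S') (d : ℕ) [SmoothOfRelativeDimension d S'.hom] :
    haveI : IsLocallyNoetherian (specOver ℚ ℂ).left :=
      inferInstanceAs (IsLocallyNoetherian (Spec (CommRingCat.of ℂ)))
    ∀ (W : Set (ComplexPoints S')) (_hW : IsPathConnected W)
      (hU : IsCohomologicallyLocallyTrivialOn (familyPullback.snd (univFamilyℂ 𝓜) ιS) W)
      (P' : W → PolarizedAbelianSchemeWithLevel g N δ (specOver ℚ ℂ).left)
      (G : ∀ x : W, (P' x).A.X.left ⟶ 𝓜.univ.A.X.left) (Ĝ : ∀ x : W, (P' x).D.hat.X.left ⟶ 𝓜.univ.D.hat.X.left)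
      (hbc : ∀ x : W, (P' x).IsBaseChangeVia 𝓜.univ
        ((AlgPoints.baseChangeEquiv (algebraMap ℚ ℂ) 𝓜.M).symm (AlgPoints.map ιS x.1)).left (G x) (Ĝ x))
      (J : W → C0pm δ)
      (mark : ∀ x : W, SiegelAdelicMarking (J x) r ((P' x).A.fibre (𝟙 (Spec (CommRingCat.of ℂ)))).toAbelianVariety)
      (_hγ1 : ∀ x, (mark x).γ = 1)
      (fr : ∀ x : W, Fin g ⊕ Fin g →
        singularCohomology ℚ ℚ (ComplexPoints (fiberOver (familyPullback.snd (univFamilyℂ 𝓜) ιS) x.1)) 1),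
      (∀ (x x' : W) (p : Path.Homotopic.Quotient x x') (a : Fin g ⊕ Fin g),
        transportFun (familyPullback.snd (univFamilyℂ 𝓜) ιS) 1 hU p (ofRatClass _ 1 (fr x a)) = ofRatClass _ 1 (fr x' a)) →
      (∀ (x : W) (a : Fin g ⊕ Fin g),
        singularCohomology.map ℚ ℚ
          (((AlgPoints.homeomorphOfIso (L := ℂ)
              (fibreAVIso (P' x) ≪≫ (fiberUnivIsoOfIsBaseChangeVia 𝓜 (AlgPoints.map ιS x.1) (P' x) (G x) (Ĝ x) (hbc x)).symm ≪≫
                (fiberOverFamilyPullbackIso (univFamilyℂ 𝓜) ιS x.1).symm) :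
              ((P' x).A.fibre (𝟙 (Spec (CommRingCat.of ℂ)))).toAbelianVariety.Points ℂ ≃ₜ
                ComplexPoints (fiberOver (familyPullback.snd (univFamilyℂ 𝓜) ιS) x.1)) :
              C(((P' x).A.fibre (𝟙 (Spec (CommRingCat.of ℂ)))).toAbelianVariety.Points ℂ,
                ComplexPoints (fiberOver (familyPullback.snd (univFamilyℂ 𝓜) ιS) x.1))).comp
            ⟨(mark x).toFun, (mark x).isAnalytification.isHomeomorph.continuous⟩) 1 (fr x a) =
          latticeClass (mark x).Ψ a) →
      ∀ (i : Fin g ⊕ Fin g) (v : Fin g ⊕ Fin g → ℚ) (x₀ : W),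
        (P' x₀).A.restrictPt (𝟙 (Spec (CommRingCat.of ℂ))) ((P' x₀).level.σ i) = (mark x₀).r v →
        ∀ x : W, (P' x).A.restrictPt (𝟙 (Spec (CommRingCat.of ℂ))) ((P' x).level.σ i) = (mark x).r v := by
  intro W hW hU P' G Ĝ hbc J mark hγ1 fr hflat hframe i v x₀ hx₀ x
  classical
  have hN0 : N ≠ 0 := by omega
  -- ### instances for ★ (E2-core) on the piece family `f₁`
  have hf := UnivFamilyHodgeFrames.isSmoothProjectiveFamily_familyPullback_univFamilyℂ 𝓜 ιS
  haveI : SmoothOfRelativeDimension g (familyPullback.snd (univFamilyℂ 𝓜) ιS).left := hf.smoothOfRelativeDimension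
  haveI : Smooth (familyPullback.snd (univFamilyℂ 𝓜) ιS).left := SmoothOfRelativeDimension.smooth g _
  haveI : IsProper (familyPullback.snd (univFamilyℂ 𝓜) ιS).left := hf.isProper
  haveI : LocallyOfFiniteType S'.hom := hSq.isVarietyPair_ofScheme.locallyOfFiniteType
  haveI : IsSeparated S'.hom := hSq.isVarietyPair_ofScheme.isSeparated
  haveI : QuasiCompact S'.hom := hSq.isVarietyPair_ofScheme.quasiCompact
  have hXhom : (familyPullback (univFamilyℂ 𝓜) ιS).hom = (familyPullback.snd (univFamilyℂ 𝓜) ιS).left ≫ S'.hom :=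
    (Over.w (familyPullback.snd (univFamilyℂ 𝓜) ιS)).symm
  haveI : LocallyOfFiniteType (familyPullback (univFamilyℂ 𝓜) ιS).hom := by rw [hXhom]; infer_instance
  haveI : IsSeparated (familyPullback (univFamilyℂ 𝓜) ιS).hom := by rw [hXhom]; infer_instance
  haveI : QuasiCompact (familyPullback (univFamilyℂ 𝓜) ιS).hom := by rw [hXhom]; infer_instance
  haveI : CompactSpace (familyPullback (univFamilyℂ 𝓜) ιS).left :=
    QuasiCompact.compactSpace_of_compactSpace (familyPullback (univFamilyℂ 𝓜) ιS).hom
  haveI : CompactSpace S'.left := QuasiCompact.compactSpace_of_compactSpace S'.hom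
  haveI : SecondCountableTopology (ComplexPoints (familyPullback (univFamilyℂ 𝓜) ιS)) :=
    ComplexPoints.secondCountableTopology_of_compactSpace_holds _
  haveI : SecondCountableTopology (ComplexPoints S') := ComplexPoints.secondCountableTopology_of_compactSpace_holds _
  -- ### the piece-pinned identifications and the torus charts `u x := e₁ x ∘ (mark x).toFun`
  let e : ∀ y : W, ((P' y).A.fibre (𝟙 (Spec (CommRingCat.of ℂ)))).toAbelianVariety.Points ℂ ≃ₜ
      ComplexPoints (fiberOver (familyPullback.snd (univFamilyℂ 𝓜) ιS) y.1) := fun y ↦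
    AlgPoints.homeomorphOfIso (L := ℂ)
      (fibreAVIso (P' y) ≪≫ (fiberUnivIsoOfIsBaseChangeVia 𝓜 (AlgPoints.map ιS y.1) (P' y) (G y) (Ĝ y) (hbc y)).symm ≪≫
        (fiberOverFamilyPullbackIso (univFamilyℂ 𝓜) ιS y.1).symm)
  let u : ∀ y : W, C(ComplexTorus (mark y).Ψ, ComplexPoints (fiberOver (familyPullback.snd (univFamilyℂ 𝓜) ιS) y.1)) :=
    fun y ↦
    (e y : C(((P' y).A.fibre (𝟙 (Spec (CommRingCat.of ℂ)))).toAbelianVariety.Points ℂ,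
        ComplexPoints (fiberOver (familyPullback.snd (univFamilyℂ 𝓜) ιS) y.1))).comp
      ⟨(mark y).toFun, (mark y).isAnalytification.isHomeomorph.continuous⟩
  have hu_apply : ∀ (y : W) (t : ComplexTorus (mark y).Ψ), u y t = e y ((mark y).toFun t) := fun _ _ ↦ rfl
  have hu : ∀ y, Function.Bijective (u y) := fun y ↦ (e y).bijective.comp (mark y).bijective
  -- ### the universal section `σᵢ` and `[N]`, complexified and lifted to the piece total space
  let σM : 𝓜.M ⟶ univTotal 𝓜 := Over.homMk (𝓜.univ.level.σ i).left (by
    change (𝓜.univ.level.σ i).left ≫ 𝓜.univ.A.X.hom ≫ 𝓜.M.hom = 𝓜.M.hom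
    rw [← Category.assoc]
    erw [Over.w (𝓜.univ.level.σ i)]
    exact Category.id_comp _)
  have hσM : σM.left = (𝓜.univ.level.σ i).left := rfl
  have hσMf : (Motives.baseChange ℚ ℂ).map σM ≫ univFamilyℂ 𝓜 = 𝟙 _ := by
    change (Motives.baseChange ℚ ℂ).map σM ≫ (Motives.baseChange ℚ ℂ).map (univFamily 𝓜) = _
    have hsec : σM ≫ univFamily 𝓜 = 𝟙 _ := by
      ext : 1
      exact Over.w (𝓜.univ.level.σ i)
    rw [← Functor.map_comp, hsec, CategoryTheory.Functor.map_id]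
  let σ₁ : S' ⟶ familyPullback (univFamilyℂ 𝓜) ιS :=
    Over.homMk (pullback.lift (ιS ≫ (Motives.baseChange ℚ ℂ).map σM).left (𝟙 _) (by
      rw [Over.comp_left, Category.assoc, ← Over.comp_left, hσMf, Over.id_left, Category.comp_id, Category.id_comp])) (by
      change pullback.lift _ _ _ ≫ pullback.fst _ _ ≫ _ = _
      rw [pullback.lift_fst_assoc]
      exact Over.w _)
  have hσ₁ : σ₁ ≫ familyPullback.fst (univFamilyℂ 𝓜) ιS = ιS ≫ (Motives.baseChange ℚ ℂ).map σM := by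
    ext : 1
    exact pullback.lift_fst _ _ _
  have hσ₁' : σ₁ ≫ familyPullback.snd (univFamilyℂ 𝓜) ιS = 𝟙 S' := by
    ext : 1
    exact pullback.lift_snd _ _ _
  let nX : univTotal 𝓜 ⟶ univTotal 𝓜 :=
    Over.homMk ((((𝟙 𝓜.univ.A.X : 𝓜.univ.A.X ⟶ 𝓜.univ.A.X) ^ N).left : 𝓜.univ.A.X.left ⟶ 𝓜.univ.A.X.left)) (by
      change _ ≫ 𝓜.univ.A.X.hom ≫ 𝓜.M.hom = 𝓜.univ.A.X.hom ≫ 𝓜.M.hom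
      rw [← Category.assoc, Over.w])
  have hnX : nX.left = (((𝟙 𝓜.univ.A.X : 𝓜.univ.A.X ⟶ 𝓜.univ.A.X) ^ N).left : 𝓜.univ.A.X.left ⟶ 𝓜.univ.A.X.left) :=
    rfl
  have hnXf : (Motives.baseChange ℚ ℂ).map nX ≫ univFamilyℂ 𝓜 = univFamilyℂ 𝓜 := by
    change (Motives.baseChange ℚ ℂ).map nX ≫ (Motives.baseChange ℚ ℂ).map (univFamily 𝓜) =
      (Motives.baseChange ℚ ℂ).map (univFamily 𝓜)
    rw [← Functor.map_comp]
    congr 1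
    ext : 1
    exact Over.w (((𝟙 𝓜.univ.A.X : 𝓜.univ.A.X ⟶ 𝓜.univ.A.X) ^ N))
  let nX₁ : familyPullback (univFamilyℂ 𝓜) ιS ⟶ familyPullback (univFamilyℂ 𝓜) ιS :=
    Over.homMk (pullback.lift (pullback.fst _ _ ≫ ((Motives.baseChange ℚ ℂ).map nX).left) (pullback.snd _ _) (by
      rw [Category.assoc, ← Over.comp_left, hnXf]
      exact pullback.condition)) (by
      change pullback.lift _ _ _ ≫ pullback.fst _ _ ≫ _ = pullback.fst _ _ ≫ _
      rw [pullback.lift_fst_assoc]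
      exact (Category.assoc _ _ _).trans
        (congrArg (pullback.fst (univFamilyℂ 𝓜).left ιS.left ≫ ·) (Over.w ((Motives.baseChange ℚ ℂ).map nX))))
  have hnX₁ : nX₁ ≫ familyPullback.fst (univFamilyℂ 𝓜) ιS =
      familyPullback.fst (univFamilyℂ 𝓜) ιS ≫ (Motives.baseChange ℚ ℂ).map nX := by
    ext : 1
    exact pullback.lift_fst _ _ _
  have hnX₁' : nX₁ ≫ familyPullback.snd (univFamilyℂ 𝓜) ιS = familyPullback.snd (univFamilyℂ 𝓜) ιS := by
    ext : 1
    exact pullback.lift_snd _ _ _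
  have hnX₁f : nX₁ ≫ familyPullback.snd (univFamilyℂ 𝓜) ιS = familyPullback.snd (univFamilyℂ 𝓜) ιS := hnX₁'
  -- ### the torsion points `σᵢ(y)` are `toFun [w(y)/N]`
  have hQ : ∀ y : W, ∃ w : Fin g ⊕ Fin g → ℤ,
      (mark y).toFun (ComplexTorus.proj (mark y).Ψ fun a ↦ (w a : ℝ) / N) =
        (P' y).A.restrictPt (𝟙 (Spec (CommRingCat.of ℂ))) ((P' y).level.σ i) := by
    intro y
    obtain ⟨t, ht⟩ := (mark y).bijective.2 ((P' y).A.restrictPt (𝟙 (Spec (CommRingCat.of ℂ))) ((P' y).level.σ i))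
    have hNt : N • t = 0 := by
      apply (mark y).bijective.1
      rw [(mark y).toFun_nsmul, ht, (mark y).toFun_zero]
      exact AbelianSchemeOver.restrictPt_pow_eq_one _ _ ((P' y).level.pow_σ i)
    obtain ⟨w, hw⟩ := exists_eq_proj_intCast_div_of_nsmul_eq_zero (mark y).Ψ hN0 t hNt
    exact ⟨w, by rw [← hw, ht]⟩
  choose w hw using hQ
  -- ### ★ (E2-core): the readings `w(y) mod N` are constant on `W`
  have key : ∀ a, (w x a : ZMod N) = (w x₀ a : ZMod N) := fun a ↦
    torsionReading_const_of_flatFrame_family (familyPullback.snd (univFamilyℂ 𝓜) ιS) g d hW hU (fun y ↦ (mark y).Ψ)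
      u hu fr hflat hframe N (by omega) nX₁ hnX₁f
      (fun y t ↦ by
        rw [hu_apply, hu_apply, (mark y).toFun_nsmul]
        exact (map_fiberι_piecePinned_pow 𝓜 ιS y.1 (P' y) (G y) (Ĝ y) (hbc y) N nX hnX nX₁ hnX₁ hnX₁'
          ((mark y).toFun t)).symm)
      (fun y ↦ AlgPoints.map σ₁ y.1)
      ((AlgPoints.continuous_map _).comp continuous_subtype_val) w
      (fun y ↦ by
        rw [hu_apply, hw y]
        exact (map_fiberι_piecePinned_restrictPt 𝓜 ιS y.1 (P' y) (G y) (Ĝ y) (hbc y) i σM hσM σ₁ hσ₁ hσ₁').symm)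
      x x₀ a
  -- ### at `x₀`: `[w(x₀)/N] = [ṽ]`, hence at `x`
  have h0 : (ComplexTorus.proj (mark x₀).Ψ fun a ↦ (w x₀ a : ℝ) / N) =
      ComplexTorus.proj (mark x₀).Ψ fun a ↦ ((v a : ℚ) : ℝ) := by
    apply (mark x₀).bijective.1
    rw [hw x₀, hx₀, SiegelAdelicMarking.r_eq_toFun_proj_of_γ_eq_one (mark x₀) (hγ1 x₀) v]
  have hx' : (ComplexTorus.proj (mark x).Ψ fun a ↦ (w x₀ a : ℝ) / N) =
      ComplexTorus.proj (mark x).Ψ fun a ↦ ((v a : ℚ) : ℝ) := h0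
  rw [← hw x, proj_intCast_div_eq_of_intCast_eq (mark x).Ψ hN0 key, hx',
    SiegelAdelicMarking.r_eq_toFun_proj_of_γ_eq_one (mark x) (hγ1 x) v]

end PieceHead

end UnivFamilyLevelReadings

end Summit.HodgeConjecture.HodgeConjecture.Theorems

end
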